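import Summits.BirchSwinnertonDyer.BirchSwinnertonDyer.Theorems.PrintX11aUpperNonSurjFiveExcToolkit
import HarnessLib

/-!
# Crux U5 `PrintX11a.UpperNonSurjFive` (item stmt-BirchSwinnertonDyer-20614), line «gl1cartan5», EXCEPTIONAL-ZERO road:
# the roots `α, β` of the Hecke polynomial `X² − a_ℓ X + ℓ` modulo `𝔪` at a GENERAL prime `p` (including `ℓ = p`)

Cell `bsd-print-x11a`, seat `cruxlead-stmt-BirchSwinnertonDyer-20614` (LEAD g6); `--supports stmt-BirchSwinnertonDyer-20614`,
closes nothing. Sequel of `…ExcToolkit` (file 1b of the EXCEPTIONAL-ZERO road): the root bookkeeping of the bsd-addord acc2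
files `KimAtThreeDeepLowerOffStratumLevelLowering{ConditionOne §3, DoubleStabData §1, VatsalStabRows §3}` re-proved over
`ℚ̄_p = PadicAlgCl p` for an arbitrary prime `p` (proofs copied with `3 ↦ p`). The point for the exceptional-zero road: at
the stabilisation prime `ℓ = p` itself the residual roots of `X² − a_p(g)X + p ≡ X(X − a_p(g))` are `{u, 0}` with
`u = a_p(E) = ±1`, the ordinary root `α ≡ u` is a unit, `β ≡ up ≡ 0`, and `c = β/p = α⁻¹ ≡ u⁻¹` — for `u = 1` (SPLIT
multiplicative `p`) `c ≡ 1`, so the `p`-stabilised symbol `{∞,0} − c{∞, p·0} = (1 − c){∞,0}` vanishes modulo `𝔪`.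
Theorems only: no definition, no named fact, no `sorry`; BSD is not proved by any of this.

* `norm_lt_one_or_of_mul`, `exists_root_valuation_sub_lt_one_sign` (`β ≡ uℓ`, `α = a − β ≡ u`),
  `valuation_div_sub_one_lt_one` (`a ≡ q + 1`, `β ≡ q` ⇒ `α ≡ 1` and `c = β/q ≡ 1`; valid at `q = p`).

## References

* V. Vatsal, Duke Math. J. 98 (1999), §1 [Vatsal1999]; R. Greenberg, V. Vatsal, Invent. Math. 142 (2000), §3 Lemma (3.6)
  (the `q`-deprived / stabilised eigenform) [GreenbergVatsal2000]; F. Diamond, J. Shurman (2005), §5.7 [DiamondShurman2005].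
-/

set_option autoImplicit false
-- the Theorems namespace of a single-conjunct summit repeats the summit name by design (D-0017)
set_option linter.dupNamespace false

noncomputable section

open scoped MatrixGroups ModularForm Classical NNReal

open CongruenceSubgroup WeierstrassCurve Polynomial Literature.NumberTheory.EllipticCurves
  Literature.NumberTheory.EllipticCurves.ModularForms

namespace Summit.BirchSwinnertonDyer.BirchSwinnertonDyer.Theorems.GL1Cartan.Exc

open Literature.NumberTheory.EllipticCurves.ModularForms.DeligneSerreLift (norm_intCast_le_one)

/-! ### §3 The roots of `X² − aX + ℓ` modulo `𝔪`, and `c = β/ℓ ≡ 1` -/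

section Roots

variable {p : ℕ} [Fact p.Prime]

/-- In `𝒪_{ℚ̄_p}`: a product of two integers of norm `< 1` has a factor of norm `< 1`. [folklore] -/
theorem norm_lt_one_or_of_mul {x y : PadicAlgCl p} (hx : ‖x‖ ≤ 1) (hy : ‖y‖ ≤ 1) (hxy : ‖x * y‖ < 1) :
    ‖x‖ < 1 ∨ ‖y‖ < 1 := by
  by_contra h
  push Not at h
  have hx1 : ‖x‖ = 1 := le_antisymm hx h.1
  have hy1 : ‖y‖ = 1 := le_antisymm hy h.2
  rw [norm_mul, hx1, hy1, mul_one] at hxy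
  exact lt_irrefl _ hxy

/-- **A root `β ≡ uℓ (mod 𝔪)` of `X² − aX + ℓ` when `a` is `p`-integral and `a ≡ u(ℓ + 1)` with `u² = 1`** (the
residual roots are `{u, uℓ}`; if the first root is `≢ uℓ` it is `≡ u` and the other one `a − β₀ ≡ uℓ`); the
complementary root then satisfies `a − β ≡ u`. (At `ℓ = p`: `β ≡ 0`, `α = a − β ≡ u`.) [folklore] -/
theorem exists_root_valuation_sub_lt_one_sign (ι : PadicAlgCl p ≃+* ℂ) {a : ℂ} (ha : Valued.v (ι.symm a) ≤ 1)
    (ℓ : ℕ) {u : ℤ} (hu : u * u = 1) (haq : Valued.v (ι.symm (a - u * (ℓ + 1))) < 1) :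
    ∃ β : ℂ, β ^ 2 - a * β + ℓ = 0 ∧ Valued.v (ι.symm (β - u * ℓ)) < 1 ∧ Valued.v (ι.symm (a - β - u)) < 1 := by
  obtain ⟨s, hs⟩ := IsAlgClosed.exists_eq_mul_self (a ^ 2 - 4 * ℓ : ℂ)
  set β₀ : ℂ := (a + s) / 2 with hβ₀
  have hroot : ∀ b : ℂ, b = β₀ ∨ b = a - β₀ → b ^ 2 - a * b + ℓ = 0 := by
    rintro b (rfl | rfl)
    · rw [hβ₀]; linear_combination (-1 / 4 : ℂ) * hs
    · rw [hβ₀]; linear_combination (-1 / 4 : ℂ) * hs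
  have h0 : β₀ ^ 2 - a * β₀ + ℓ = 0 := hroot β₀ (Or.inl rfl)
  have ha' : ‖ι.symm a‖ ≤ 1 := valuation_le_one_iff.mp ha
  have hx : ‖ι.symm β₀‖ ≤ 1 := by
    refine norm_root_le_one (q := ℓ) ha' ?_
    have := congrArg ι.symm h0
    simpa [map_sub, map_add, map_mul, map_pow, map_natCast] using this
  have hℓ1 : ‖(ℓ : PadicAlgCl p)‖ ≤ 1 := by
    have := norm_intCast_le_one (p := p) (ℓ : ℤ); rwa [Int.cast_natCast] at this
  have hu1 : ‖((u : ℤ) : PadicAlgCl p)‖ ≤ 1 := norm_intCast_le_one u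
  have hfac : (ι.symm β₀ - u) * (ι.symm β₀ - u * ℓ) = ι.symm (a - u * (ℓ + 1)) * ι.symm β₀ := by
    have h := congrArg ι.symm h0
    simp only [map_sub, map_add, map_mul, map_pow, map_natCast, map_zero, map_one, map_intCast] at h ⊢
    have hu'' : ((u : PadicAlgCl p)) * (u : PadicAlgCl p) = 1 := by exact_mod_cast hu
    linear_combination h + (ℓ : PadicAlgCl p) * hu''
  have hprod : ‖(ι.symm β₀ - u) * (ι.symm β₀ - u * ℓ)‖ < 1 := by
    rw [hfac, norm_mul]
    exact mul_lt_one_of_nonneg_of_lt_one_left (norm_nonneg _) (valuation_lt_one_iff.mp haq) hx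
  have h1x : ‖ι.symm β₀ - u‖ ≤ 1 := by
    rw [sub_eq_add_neg]; exact (PadicAlgCl.isNonarchimedean p _ _).trans (max_le hx (by rw [norm_neg]; exact hu1))
  have hqx : ‖ι.symm β₀ - u * ℓ‖ ≤ 1 := by
    rw [sub_eq_add_neg]
    refine (PadicAlgCl.isNonarchimedean p _ _).trans (max_le hx ?_)
    rw [norm_neg, norm_mul]; exact mul_le_one₀ hu1 (norm_nonneg _) hℓ1
  have hcomp : ∀ β : ℂ, Valued.v (ι.symm (β - u * ℓ)) < 1 → Valued.v (ι.symm (a - β - u)) < 1 := by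
    intro β hβ
    have : ι.symm (a - β - u) = ι.symm (a - u * (ℓ + 1)) - ι.symm (β - u * ℓ) := by
      simp only [map_sub, map_add, map_mul, map_natCast, map_one, map_intCast]; ring
    rw [this, sub_eq_add_neg]
    refine lt_of_le_of_lt (Valuation.map_add _ _ _) (max_lt haq ?_)
    rwa [Valuation.map_neg]
  rcases norm_lt_one_or_of_mul h1x hqx hprod with h1 | h2
  · have hβ : Valued.v (ι.symm (a - β₀ - u * ℓ)) < 1 := by
      have : ι.symm (a - β₀ - u * ℓ) = ι.symm (a - u * (ℓ + 1)) - (ι.symm β₀ - u) := by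
        simp only [map_sub, map_add, map_mul, map_natCast, map_one, map_intCast]; ring
      rw [valuation_lt_one_iff, this, sub_eq_add_neg]
      refine lt_of_le_of_lt (PadicAlgCl.isNonarchimedean p _ _) (max_lt (valuation_lt_one_iff.mp haq) ?_)
      rwa [norm_neg]
    exact ⟨a - β₀, hroot _ (Or.inr rfl), hβ, hcomp _ hβ⟩
  · have hβ : Valued.v (ι.symm (β₀ - u * ℓ)) < 1 :=
      valuation_lt_one_iff.mpr (by simpa [map_sub, map_mul, map_natCast, map_intCast] using h2)
    exact ⟨β₀, h0, hβ, hcomp _ hβ⟩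

/-- **`c = β/q ≡ 1` and `α = a − β ≡ 1`** when `a ≡ q + 1`, `β ≡ q` and `β² − aβ + q = 0` (so `αβ = q`,
`c = α⁻¹`): `v(c − 1) = v(1 − α) < 1`. Holds verbatim at `q = p` (`β ≡ p ≡ 0`, `α ≡ 1`, `c = 1/α`: the
`p`-STABILISATION of the exceptional-zero road). [folklore] -/
theorem valuation_div_sub_one_lt_one (ι : PadicAlgCl p ≃+* ℂ) {a β : ℂ} {q : ℕ} (hq : q.Prime)
    (hβ : β ^ 2 - a * β + q = 0) (ha : Valued.v (ι.symm (a - (q + 1))) < 1)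
    (hβq : Valued.v (ι.symm (β - q)) < 1) :
    Valued.v (ι.symm (a - β - 1)) < 1 ∧ Valued.v (ι.symm (β / q - 1)) < 1 := by
  have hα1 : Valued.v (ι.symm (a - β - 1)) < 1 := by
    have : ι.symm (a - β - 1) = ι.symm (a - (q + 1)) - ι.symm (β - q) := by
      rw [← map_sub]; congr 1; ring
    rw [this]
    exact lt_of_le_of_lt (Valuation.map_sub _ _ _) (max_lt ha hβq)
  refine ⟨hα1, ?_⟩
  set α : PadicAlgCl p := ι.symm (a - β) with hαdef
  have hα1' : ‖α - 1‖ < 1 := by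
    rw [hαdef, ← map_one ι.symm, ← map_sub]
    exact valuation_lt_one_iff.mp hα1
  have hαnorm : ‖α‖ = 1 := by
    have h := IsUltrametricDist.norm_add_eq_max_of_norm_ne_norm (x := α - 1) (y := (1 : PadicAlgCl p))
      (by rw [norm_one]; exact hα1'.ne)
    rw [sub_add_cancel, norm_one, max_eq_right hα1'.le] at h
    exact h
  have hα0 : α ≠ 0 := fun h => by rw [h, norm_zero] at hαnorm; exact zero_ne_one hαnorm
  have hq0 : (q : PadicAlgCl p) ≠ 0 := by exact_mod_cast hq.ne_zero
  have hprod : α * ι.symm β = q := by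
    have h := congrArg ι.symm hβ
    rw [map_add, map_sub, map_pow, map_mul, map_natCast, map_zero] at h
    rw [hαdef, map_sub]
    linear_combination -h
  have hβ0 : ι.symm β ≠ 0 := fun h => hq0 (by rw [← hprod, h, mul_zero])
  have key : ι.symm (β / q - 1) = (1 - α) / α := by
    rw [map_sub, map_one, map_div₀, map_natCast, ← hprod]
    field_simp
  refine valuation_lt_one_iff.mpr ?_
  rw [key, norm_div, hαnorm, div_one, ← norm_neg, neg_sub]
  exact hα1'

end Roots

end Summit.BirchSwinnertonDyer.BirchSwinnertonDyer.Theorems.GL1Cartan.Exc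

end
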